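import Summits.Ventures.CertifiedManyBodySolver.Rows.SourcedTorusRowsOnePointKKT
import Literature.MathematicalPhysics.QuantumLattice.DWaveSourceNNNHoppingTwistedFlipWindowCertificateKKT
import HarnessLib

/-!
# PINNING-FIELD rows: window certificates with FLIP-TWISTED defects (the sixteen-element twisted
# `D₄ × ℤ₂^{flip}` of the sourced engines) instantiate the canonical one-point cell, the response leaves and the
# energy floor cell

HONEST FRAMING: first certified bounds on pairing observables; not a superconductivity verdict; every
number certified (two lineages + referee) or labelled float. A response AT FIXED `h > 0` is
symmetry-allowed and says nothing about spontaneous order.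

WHAT THIS FILE IS (cell hubbard-cq, D-0082 (c) / LADDER row PC-a, seat hubbard-cq-obsth-1 "pinning-field K5
menu nodes"; twin of `Rows/SourcedTorusRowsTwistedHook.lean` for the family WITH SPIN EXCHANGE
`T((v, γ), f, m) = U_v D_γ F^f 𝒢_{j(γ)+f+2m}`, `Literature/…/TwistedFlipSpaceGroupUnitary`, which commutes with the
pair-sourced torus for EVERY `S ⊆ D₄`, `Literature/…/DWaveSourceNNNHoppingTwistedFlip`). This is the identification
under which pilot-1's sourced engine (obsb ≥ 0.3.0, `gauge_twist = true`, `spin_flip = true`) builds every sourced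
certificate of the cell: the window theorems `re_orbitState_ge_of_twistedFlip_sourced_window_certificate_TT'_kkt[_of_energy_le]`,
`dWaveSourceTorusTT'_groundEnergy_ge_of_twistedFlip_window_certificate_kkt`
(`Literature/…/DWaveSourceNNNHoppingTwistedFlipWindowCertificate[KKT]`) read ONE window identity whose symmetry defects are
`bₗ • (φₗ • Γ(incl)(Γ(d4Emb γₗ wₗ)(F^{fₗ} Wₗ)) − Γ(incl) Wₗ)` (`F^f W = spinSwapIter f W`,
`φₗ = gaugePhase (twistFlipExp γₗ fₗ mₗ) (yw l) = i^{(j(γₗ)+fₗ+2mₗ) q(Wₗ)}`), and this file turns them into: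

* §1 `re_orbitState_twistedFlipSpaceGroup_onePointPairWord_eq_div` (the flip-twisted orbit state of the pulled-back
  one-point word is the response per site);
* §2 `SourcedTorusCorrLowerRowGS.onePoint_of_twistedFlip_bound` / upper twin (⇒ the canonical `{1}` one-point cell);
* §3 END TO END `pinFieldResponseFloorAt_of_onePoint_twistedFlip_window_certificate_kkt[_of_energyUpperRow]`,
  `pinFieldResponseCeilingAt_of_onePoint_twistedFlip_window_certificate_kkt`;
* §4 `SourcedEnergyLowerRow.of_twistedFlip_window_certificate_kkt`.

NOTHING IS ASSERTED: identities in, cells / leaves out; no certificate, no number, no `sorry`, no named fact.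
No definition. Elaborated under the torus files' local `DecidableEq (FermionTorus 2 L)` instance.

References: T. Koma, H. Tasaki, J. Stat. Phys. 76 (1994) 745, §1; O. Bratteli, D. W. Robinson II §5.2.2, §6.2.4;
G. Benfatto, A. Giuliani, V. Mastropietro, AHP 7 (2006) 809, §2.1; X. Han, arXiv:2006.06002 §3; M. Araújo et al.,
arXiv:2311.18707 §3.2 Prop. 11; J. Wang et al., PRX 14 (2024) 031006, §III.
-/

noncomputable section

namespace Summit.Ventures.CertifiedManyBodySolver

open Literature.MathematicalPhysics.QuantumLattice
open Matrix HubbardWave0 Literature.Probability.LatticeModels Finset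
open Literature.MathematicalPhysics.QuantumManyBody.StateRelaxation
open Summit.Ventures.CertifiedManyBodySolver.Observables
open scoped BigOperators ComplexOrder

/-- (Local to this file, as in `Rows/SourcedTorusRows[OnePointD4]`.) -/
local instance (priority := high) instDecidableEqFermionTorusSourcedTwFHook {L : ℕ} :
    DecidableEq (FermionTorus 2 L) :=
  LinearOrder.toDecidableEq

/-! ## §1  The twisted orbit state of the one-point word is the response per site -/

section Dictionary

variable {L : ℕ} [NeZero L]

/-- **The twisted orbit state of `Δ_d + Δ_dᴴ` is the plain expectation** for every nonempty `S ⊆ D₄`: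
`ω̄^{tw,F}_ψ(Δ_d + Δ_dᴴ) = ⟨ψ, (Δ_d + Δ_dᴴ) ψ⟩` (each twisted member fixes `Δ_d + Δ_dᴴ`).
[cite: BratteliRobinsonII1997, §6.2.4] -/
theorem orbitState_twistedFlipSpaceGroup_pairField_add_conjTranspose {S : Finset (DihedralGroup 4)} (hne : S.Nonempty)
    (ψ : Fock (Orb (FermionTorus 2 L))) :
    orbitState (twistedFlipSpaceGroupUnitary S) ψ (pairField dWaveFormFactor L + (pairField dWaveFormFactor L)ᴴ) =
      star ψ ⬝ᵥ (pairField dWaveFormFactor L + (pairField dWaveFormFactor L)ᴴ) *ᵥ ψ := by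
  haveI : Nonempty ↥S := hne.coe_sort
  set Op := pairField dWaveFormFactor L + (pairField dWaveFormFactor L)ᴴ with hOp
  have hg : ∀ g : ((TorusSite 2 L × ↥S) × Fin 2) × Fin 2,
      Literature.MathematicalPhysics.QuantumManyBody.StateRelaxation.vectorState ((twistedFlipSpaceGroupUnitary S g)ᴴ *ᵥ ψ) Op =
        star ψ ⬝ᵥ Op *ᵥ ψ := by
    intro g
    have hTT' : (twistedFlipSpaceGroupUnitary S g)ᴴ * twistedFlipSpaceGroupUnitary S g = 1 :=
      twistedFlipSpaceGroupUnitary_conjTranspose_mul_self S g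
    have hTT : twistedFlipSpaceGroupUnitary S g * (twistedFlipSpaceGroupUnitary S g)ᴴ = 1 := mul_eq_one_comm.mp hTT'
    have hcomm : twistedFlipSpaceGroupUnitary S g * Op = Op * twistedFlipSpaceGroupUnitary S g :=
      twistedFlipSpaceGroupUnitary_mul_pairField_add_conjTranspose (L := L) S g
    rw [Literature.MathematicalPhysics.QuantumManyBody.StateRelaxation.vectorState_apply, star_mulVec,
      conjTranspose_conjTranspose, ← dotProduct_mulVec, mulVec_mulVec, mulVec_mulVec, hcomm,
      Matrix.mul_assoc, hTT, Matrix.mul_one]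
  rw [orbitState_apply]
  simp_rw [hg]
  rw [Finset.sum_const, Finset.card_univ, nsmul_eq_mul, ← mul_assoc,
    inv_mul_cancel₀ (Nat.cast_ne_zero.mpr Fintype.card_ne_zero), one_mul]

/-- **The twisted orbit state of the pulled-back one-point word is Koma–Tasaki's response per site**: for
`S ∋ 1` closed under products (ANY subset of `D₄`), every window `Λ' ⊇` pair region and every vector `ψ`,
`Re ω̄^{tw,F}_ψ(Γ(ι_{Λ',L}) Γ(incl)(Φ₀ + Φ₀ᴴ)) = Re ⟨ψ, (Δ_d + Δ_dᴴ) ψ⟩ / L²` (the translations of the twisted family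
average the word to `(Δ_d + Δ_dᴴ)/L²`). [cite: BratteliRobinsonII1997, §6.2.4] [cite: KomaTasaki1994, §1] -/
theorem re_orbitState_twistedFlipSpaceGroup_onePointPairWord_eq_div {S : Finset (DihedralGroup 4)}
    (h1 : (1 : DihedralGroup 4) ∈ S) (hmul : ∀ a ∈ S, ∀ b ∈ S, a * b ∈ S)
    {Λ' : Finset (Site 2)} (hP : pairRegion (insert (0 : Site 2) unitSteps) 0 ⊆ Λ')
    (hInj' : Set.InjOn (Torus.proj (d := 2) L) ↑Λ') (ψ : Fock (Orb (FermionTorus 2 L))) :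
    (orbitState (twistedFlipSpaceGroupUnitary S) ψ
        (fermionEmbed (PolySite.toTorusEmb L hInj') (fermionEmbed (PolySite.incl hP) onePointPairWord))).re =
      (star ψ ⬝ᵥ ((pairField dWaveFormFactor L + (pairField dWaveFormFactor L)ᴴ) *ᵥ ψ)).re / (L : ℝ) ^ 2 := by
  haveI : Nonempty ↥S := ⟨⟨1, h1⟩⟩
  have hInjP : Set.InjOn (Torus.proj (d := 2) L) ↑(pairRegion (insert (0 : Site 2) unitSteps) 0) :=
    hInj'.mono (by exact_mod_cast hP)
  have hLr : ((L : ℝ)) ^ 2 ≠ 0 := pow_ne_zero 2 (Nat.cast_ne_zero.2 (NeZero.ne L))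
  have hcomp : fermionEmbed (PolySite.toTorusEmb L hInj') (fermionEmbed (PolySite.incl hP) onePointPairWord) =
      fermionEmbed (PolySite.toTorusEmb L hInjP) onePointPairWord := by
    rw [fermionEmbed_fermionEmbed]
    exact congrFun (congrArg DFunLike.coe (fermionEmbed_congr fun p => rfl)) _
  have hT' : ∀ v' : TorusSite 2 L, ∃ σ : (((TorusSite 2 L × ↥S) × Fin 2) × Fin 2) ≃ (((TorusSite 2 L × ↥S) × Fin 2) × Fin 2), ∀ g,
      twistedFlipSpaceGroupUnitary S g * (fockTranslate v').val = twistedFlipSpaceGroupUnitary S (σ g) :=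
    fun v' => twistedFlipSpaceGroupUnitary_closed_translate h1 hmul v'
  have havg := orbitState_sum_conj (twistedFlipSpaceGroupUnitary S) ψ (fun v' : TorusSite 2 L => (fockTranslate v').val)
    hT' (fermionEmbed (PolySite.toTorusEmb L hInjP) onePointPairWord)
  rw [sum_conj_fockTranslate_fermionEmbed_onePointPairWord hInjP,
    orbitState_twistedFlipSpaceGroup_pairField_add_conjTranspose ⟨1, h1⟩ ψ, card_torusSite] at havg
  have hc : ((L ^ 2 : ℕ) : ℂ) = ((((L : ℝ)) ^ 2 : ℝ) : ℂ) := by push_cast; ring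
  have hne : ((L ^ 2 : ℕ) : ℂ) ≠ 0 := by rw [hc]; exact_mod_cast hLr
  have hsolve : orbitState (twistedFlipSpaceGroupUnitary S) ψ (fermionEmbed (PolySite.toTorusEmb L hInjP) onePointPairWord) =
      ((((L : ℝ)) ^ 2 : ℝ) : ℂ)⁻¹ *
        (star ψ ⬝ᵥ (pairField dWaveFormFactor L + (pairField dWaveFormFactor L)ᴴ) *ᵥ ψ) := by
    rw [← hc, eq_inv_mul_iff_mul_eq₀ hne]
    exact havg.symm
  rw [hcomp, hsolve, ← Complex.ofReal_inv, Complex.re_ofReal_mul, inv_mul_eq_div]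

end Dictionary

/-! ## §2  A twisted-orbit one-point bound IS the canonical one-point ground-state cell -/

section Canonical

variable {L : ℕ} [NeZero L] {tp U μ h : ℝ} {r : ℚ}

/-- **Twisted-orbit LOWER bound on the one-point word in every `S^z`-eigenvector ground vector ⇒ the canonical
one-point ground-state cell** `SourcedTorusCorrLowerRowGS L tp U μ h r _ hInjP {1} onePointPairWord`.
[cite: KomaTasaki1994, §1] -/
theorem SourcedTorusCorrLowerRowGS.onePoint_of_twistedFlip_bound {S : Finset (DihedralGroup 4)}
    (h1 : (1 : DihedralGroup 4) ∈ S) (hmul : ∀ a ∈ S, ∀ b ∈ S, a * b ∈ S)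
    {Λ' : Finset (Site 2)} (hP : pairRegion (insert (0 : Site 2) unitSteps) 0 ⊆ Λ')
    (hInj' : Set.InjOn (Torus.proj (d := 2) L) ↑Λ')
    (hInjP : Set.InjOn (Torus.proj (d := 2) L) ↑(pairRegion (insert (0 : Site 2) unitSteps) 0))
    (hb : ∀ (M : ℝ) (ψ : Fock (Orb (FermionTorus 2 L))), ψ ∈ fockSpinZSector (Λ := FermionTorus 2 L) M →
      star ψ ⬝ᵥ ψ = 1 → (dWaveSourceTorusTT' L tp U μ h).IsGroundStateVector ψ →
      ((r : ℚ) : ℝ) ≤ (orbitState (twistedFlipSpaceGroupUnitary S) ψ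
        (fermionEmbed (PolySite.toTorusEmb L hInj') (fermionEmbed (PolySite.incl hP) onePointPairWord))).re) :
    SourcedTorusCorrLowerRowGS L tp U μ h r _ hInjP ({1} : Finset (DihedralGroup 4)) onePointPairWord := by
  intro M ψ hψK hψ1 hgs
  have h := hb M ψ hψK hψ1 hgs
  rw [re_orbitState_twistedFlipSpaceGroup_onePointPairWord_eq_div h1 hmul hP hInj' ψ] at h
  rw [re_orbitState_onePointPairWord_eq_div ψ hInjP]
  exact h

/-- **Twisted-orbit LOWER bound on the NEGATED one-point word ⇒ the canonical one-point UPPER cell** at `−r`. -/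
theorem SourcedTorusCorrUpperRowGS.onePoint_of_twistedFlip_bound_neg {S : Finset (DihedralGroup 4)}
    (h1 : (1 : DihedralGroup 4) ∈ S) (hmul : ∀ a ∈ S, ∀ b ∈ S, a * b ∈ S)
    {Λ' : Finset (Site 2)} (hP : pairRegion (insert (0 : Site 2) unitSteps) 0 ⊆ Λ')
    (hInj' : Set.InjOn (Torus.proj (d := 2) L) ↑Λ')
    (hInjP : Set.InjOn (Torus.proj (d := 2) L) ↑(pairRegion (insert (0 : Site 2) unitSteps) 0))
    (hb : ∀ (M : ℝ) (ψ : Fock (Orb (FermionTorus 2 L))), ψ ∈ fockSpinZSector (Λ := FermionTorus 2 L) M →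
      star ψ ⬝ᵥ ψ = 1 → (dWaveSourceTorusTT' L tp U μ h).IsGroundStateVector ψ →
      ((r : ℚ) : ℝ) ≤ (orbitState (twistedFlipSpaceGroupUnitary S) ψ
        (fermionEmbed (PolySite.toTorusEmb L hInj') (-fermionEmbed (PolySite.incl hP) onePointPairWord))).re) :
    SourcedTorusCorrUpperRowGS L tp U μ h (-r) _ hInjP ({1} : Finset (DihedralGroup 4)) onePointPairWord := by
  intro M ψ hψK hψ1 hgs
  have h := hb M ψ hψK hψ1 hgs
  rw [map_neg, map_neg, Complex.neg_re, re_orbitState_twistedFlipSpaceGroup_onePointPairWord_eq_div h1 hmul hP hInj' ψ] at h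
  rw [re_orbitState_onePointPairWord_eq_div ψ hInjP, Rat.cast_neg]
  linarith

end Canonical

/-! ## §3  End to end: twisted KKT one-point certificates are response FLOOR / CEILING leaves -/

section EndToEnd

/-- **A KKT one-point window certificate with TWISTED defects (all of `D₄`), no cap row, is a response FLOOR leaf.**
ONE identity in `𝔄_{Λ'}` for `Γ(incl)(Φ₀ + Φ₀ᴴ)` — SOS, commutators with `H^{src,tt'}_{Λ'}`, twisted affine-`D₄` defects
`bₗ • (φₗ • Γ(incl)(Γ(d4Emb γₗ wₗ) Wₗ) − Γ(incl) Wₗ)` over `S ∋ 1` closed under products (ANY subset of `D₄`),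
`S^z`-charged words, anti-Hermitian parts, residual words and the KKT block with ARBITRARY generators — and a slot
`r ≤ c − Σₖ ‖aₖ‖` give `∃ L₀, PinFieldResponseFloorAt tp U μ h q L₀ (r/2)` (`r/2 ≤ m_L(h)` on every side `L ≥ L₀`,
`q ∣ L`; every `q`). [cite: KomaTasaki1994, §1] [cite: AraujoEtAl2023, §3.2 Prop. 11] -/
theorem pinFieldResponseFloorAt_of_onePoint_twistedFlip_window_certificate_kkt (tp U μ h : ℝ) {r : ℚ} (q : ℕ)
    {Λ Λ' : Finset (Site 2)} (hΛ : Λ ⊆ Λ') (h8 : thicken Λ 1 ⊆ Λ')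
    (h0 : thicken ({0} : Finset (Site 2)) 1 ⊆ Λ') (hz : (0 : Site 2) ∈ Λ')
    (hP : pairRegion (insert (0 : Site 2) unitSteps) 0 ⊆ Λ')
    {S : Finset (DihedralGroup 4)} (h1 : (1 : DihedralGroup 4) ∈ S) (hmul : ∀ a ∈ S, ∀ b ∈ S, a * b ∈ S)
    {m : Type*} [Fintype m] [DecidableEq m] {Λm : Matrix m m ℂ} (hΛm : Λm.PosSemidef)
    (O : m → FermionOp Λ')
    {κ' : Type*} (s : Finset κ') (B : κ' → FermionOp Λ)
    {ι : Type*} (tt : Finset ι) (γ : ι → DihedralGroup 4) (hγS : ∀ l ∈ tt, γ l ∈ S) (wv : ι → Site 2)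
    (fl mt : ι → Fin 2) (hsh : ∀ l, d4ShiftSet (γ l) (wv l) Λ ⊆ Λ') (bb : ι → ℂ)
    (yw : ι → List (Orb (PolySite Λ) × Bool))
    {ρ : Type*} (uu : Finset ρ) (b : ρ → ℂ) (cw : ρ → List (Orb (PolySite Λ') × Bool))
    (hcw : ∀ j ∈ uu, ladderSpinCharge (cw j) ≠ 0)
    {δ : Type*} (ah : Finset δ) (dc : δ → ℝ) (V : δ → FermionOp Λ')
    {κ'' : Type*} (w : Finset κ'') (a : κ'' → ℂ) (word : κ'' → List (Orb (PolySite Λ') × Bool))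
    {β : Type*} [Fintype β] [DecidableEq β] {G : Matrix β β ℂ} (hG : G.PosSemidef)
    (Bk : β → FermionOp Λ) {c : ℝ}
    (hcert : fermionEmbed (PolySite.incl hP) onePointPairWord - (c : ℂ) • (1 : FermionOp Λ') =
      gramForm Λm O +
        (∑ k ∈ s, (pairSourceWindowHamiltonianTT' dWaveFormFactor Λ' tp U μ h * fermionEmbed (PolySite.incl hΛ) (B k) -
            fermionEmbed (PolySite.incl hΛ) (B k) * pairSourceWindowHamiltonianTT' dWaveFormFactor Λ' tp U μ h) +
          ∑ l ∈ tt, bb l • (gaugePhase (twistFlipExp (γ l) (fl l) (mt l)) (yw l) •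
              fermionEmbed (PolySite.incl (hsh l))
                (fermionEmbed (PolySite.d4Emb (γ l) (wv l) Λ) (spinSwapIter (fl l).val (ladderWord (yw l)))) -
            fermionEmbed (PolySite.incl hΛ) (ladderWord (yw l))) +
          ∑ j ∈ uu, b j • ladderWord (cw j)) +
        (∑ m' ∈ ah, ((dc m' : ℝ) : ℂ) • ((V m')ᴴ - V m') + ∑ k ∈ w, a k • ladderWord (word k)) +
        kktForm (pairSourceWindowHamiltonianTT' dWaveFormFactor Λ' tp U μ h) G
          (fun b' => fermionEmbed (PolySite.incl hΛ) (Bk b')))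
    (hr : ((r : ℚ) : ℝ) ≤ c - ∑ k ∈ w, ‖a k‖) :
    ∃ L₀ : ℕ, PinFieldResponseFloorAt tp U μ h q L₀ (r / 2) := by
  obtain ⟨L₁, hL₁⟩ := exists_forall_le_injOn_proj (thicken Λ' 1)
  have hrow : SourcedCorrLowerRowGS tp U μ h q (max 3 L₁) r (pairRegion (insert (0 : Site 2) unitSteps) 0)
      ({1} : Finset (DihedralGroup 4)) onePointPairWord := by
    intro L _ hInjP hL _
    have h3 : 3 ≤ L := le_trans (le_max_left _ _) hL
    have hInj : Set.InjOn (Torus.proj (d := 2) L) ↑(thicken Λ' 1) := hL₁ L (le_trans (le_max_right _ _) hL)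
    have hInj' : Set.InjOn (Torus.proj (d := 2) L) ↑Λ' := hInj.mono (by exact_mod_cast subset_thicken Λ' 1)
    refine SourcedTorusCorrLowerRowGS.onePoint_of_twistedFlip_bound h1 hmul hP hInj' hInjP fun M ψ hψK hψ1 hgs => ?_
    exact hr.trans (re_orbitState_ge_of_twistedFlip_sourced_window_certificate_TT'_kkt tp U μ h h3 hΛ h8 h0 hz hP hInj
      hInj' h1 hmul hψK hψ1 hgs.2 _ hΛm O s B tt γ hγS wv fl mt hsh bb yw uu b cw hcw ah dc V w a word hG Bk hcert)
  exact ⟨max (max 3 L₁) 3, hrow.pinFieldResponseFloorAt⟩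

/-- **Inside an energy window (q-slotted CEILING row), twisted defects: a KKT one-point certificate with the energy
term `κ (u·1 − E^{src,tt'})`, `κ ≥ 0`, plus `SourcedEnergyUpperRow tp U μ h q L₀ u` is a response FLOOR leaf**
`∃ L₀', PinFieldResponseFloorAt tp U μ h q L₀' (r/2)` for `r ≤ c − Σₖ ‖aₖ‖`. [cite: KomaTasaki1994, §1]
[cite: WangEtAl2024, §III] -/
theorem pinFieldResponseFloorAt_of_onePoint_twistedFlip_window_certificate_kkt_of_energyUpperRow (tp U μ h : ℝ)
    {u r : ℚ} {q L₀ : ℕ} (hE : SourcedEnergyUpperRow tp U μ h q L₀ u)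
    {Λ Λ' : Finset (Site 2)} (hΛ : Λ ⊆ Λ') (h8 : thicken Λ 1 ⊆ Λ')
    (h0 : thicken ({0} : Finset (Site 2)) 1 ⊆ Λ') (hz : (0 : Site 2) ∈ Λ')
    (hP : pairRegion (insert (0 : Site 2) unitSteps) 0 ⊆ Λ')
    {S : Finset (DihedralGroup 4)} (h1 : (1 : DihedralGroup 4) ∈ S) (hmul : ∀ a ∈ S, ∀ b ∈ S, a * b ∈ S)
    {κ : ℝ} (hκ : 0 ≤ κ)
    {m : Type*} [Fintype m] [DecidableEq m] {Λm : Matrix m m ℂ} (hΛm : Λm.PosSemidef)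
    (O : m → FermionOp Λ')
    {κ' : Type*} (s : Finset κ') (B : κ' → FermionOp Λ)
    {ι : Type*} (tt : Finset ι) (γ : ι → DihedralGroup 4) (hγS : ∀ l ∈ tt, γ l ∈ S) (wv : ι → Site 2)
    (fl mt : ι → Fin 2) (hsh : ∀ l, d4ShiftSet (γ l) (wv l) Λ ⊆ Λ') (bb : ι → ℂ)
    (yw : ι → List (Orb (PolySite Λ) × Bool))
    {ρ : Type*} (uu : Finset ρ) (b : ρ → ℂ) (cw : ρ → List (Orb (PolySite Λ') × Bool))
    (hcw : ∀ j ∈ uu, ladderSpinCharge (cw j) ≠ 0)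
    {δ : Type*} (ah : Finset δ) (dc : δ → ℝ) (V : δ → FermionOp Λ')
    {κ'' : Type*} (w : Finset κ'') (a : κ'' → ℂ) (word : κ'' → List (Orb (PolySite Λ') × Bool))
    {β : Type*} [Fintype β] [DecidableEq β] {G : Matrix β β ℂ} (hG : G.PosSemidef)
    (Bk : β → FermionOp Λ) {c : ℝ}
    (hcert : fermionEmbed (PolySite.incl hP) onePointPairWord - (c : ℂ) • (1 : FermionOp Λ') -
        ((κ : ℝ) : ℂ) • ((((u : ℚ) : ℝ) : ℂ) • (1 : FermionOp Λ') -
          (fermionEmbed (PolySite.incl h0) ((hubbardTTPrimeFermionInteraction 1 tp U).meanEnergyObs 1) -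
            (μ : ℂ) • ∑ σ : Fin 2, nAt 0 hz σ -
            (h : ℂ) • (fermionEmbed (PolySite.incl hP) (localPairAt (insert (0 : Site 2) unitSteps) dWaveFormFactor 0) +
              (fermionEmbed (PolySite.incl hP) (localPairAt (insert (0 : Site 2) unitSteps) dWaveFormFactor 0))ᴴ))) =
      gramForm Λm O +
        (∑ k ∈ s, (pairSourceWindowHamiltonianTT' dWaveFormFactor Λ' tp U μ h * fermionEmbed (PolySite.incl hΛ) (B k) -
            fermionEmbed (PolySite.incl hΛ) (B k) * pairSourceWindowHamiltonianTT' dWaveFormFactor Λ' tp U μ h) +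
          ∑ l ∈ tt, bb l • (gaugePhase (twistFlipExp (γ l) (fl l) (mt l)) (yw l) •
              fermionEmbed (PolySite.incl (hsh l))
                (fermionEmbed (PolySite.d4Emb (γ l) (wv l) Λ) (spinSwapIter (fl l).val (ladderWord (yw l)))) -
            fermionEmbed (PolySite.incl hΛ) (ladderWord (yw l))) +
          ∑ j ∈ uu, b j • ladderWord (cw j)) +
        (∑ m' ∈ ah, ((dc m' : ℝ) : ℂ) • ((V m')ᴴ - V m') + ∑ k ∈ w, a k • ladderWord (word k)) +
        kktForm (pairSourceWindowHamiltonianTT' dWaveFormFactor Λ' tp U μ h) G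
          (fun b' => fermionEmbed (PolySite.incl hΛ) (Bk b')))
    (hr : ((r : ℚ) : ℝ) ≤ c - ∑ k ∈ w, ‖a k‖) :
    ∃ L₀' : ℕ, PinFieldResponseFloorAt tp U μ h q L₀' (r / 2) := by
  obtain ⟨L₁, hL₁⟩ := exists_forall_le_injOn_proj (thicken Λ' 1)
  have hrow : SourcedCorrLowerRowGS tp U μ h q (max (max 3 L₁) L₀) r (pairRegion (insert (0 : Site 2) unitSteps) 0)
      ({1} : Finset (DihedralGroup 4)) onePointPairWord := by
    intro L _ hInjP hL hqL
    have h3 : 3 ≤ L := le_trans (le_max_left _ _) (le_trans (le_max_left _ _) hL)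
    have hInj : Set.InjOn (Torus.proj (d := 2) L) ↑(thicken Λ' 1) :=
      hL₁ L (le_trans (le_max_right _ _) (le_trans (le_max_left _ _) hL))
    have hInj' : Set.InjOn (Torus.proj (d := 2) L) ↑Λ' := hInj.mono (by exact_mod_cast subset_thicken Λ' 1)
    have hLsq : (0 : ℝ) < (L : ℝ) ^ 2 := by
      have : (0 : ℝ) < (L : ℝ) := by exact_mod_cast Nat.pos_of_ne_zero (NeZero.ne L)
      positivity
    have hu : (dWaveSourceTorusTT' L tp U μ h).groundEnergy / (L : ℝ) ^ 2 ≤ ((u : ℚ) : ℝ) := by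
      rw [div_le_iff₀ hLsq]
      exact hE L (le_trans (le_max_right _ _) hL) hqL
    refine SourcedTorusCorrLowerRowGS.onePoint_of_twistedFlip_bound h1 hmul hP hInj' hInjP fun M ψ hψK hψ1 hgs => ?_
    exact hr.trans (re_orbitState_ge_of_twistedFlip_sourced_window_certificate_TT'_kkt_of_energy_le tp U μ h h3 hΛ h8 h0
      hz hP hInj hInj' h1 hmul hψK hψ1 hgs.2 _ hκ hu hΛm O s B tt γ hγS wv fl mt hsh bb yw uu b cw hcw ah dc V w a word
      hG Bk hcert)
  exact ⟨max (max (max 3 L₁) L₀) 3, hrow.pinFieldResponseFloorAt⟩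

/-- **MAX program, twisted defects, no cap row: a KKT one-point certificate for `−Γ(incl)(Φ₀ + Φ₀ᴴ)` is a response
CEILING leaf** `∃ L₀, PinFieldResponseCeilingAt tp U μ h q L₀ (−r/2)` (`m_L(h) ≤ −r/2`) for `r ≤ c − Σₖ ‖aₖ‖`.
[cite: KomaTasaki1994, §1] [cite: AraujoEtAl2023, §3.2 Prop. 11] -/
theorem pinFieldResponseCeilingAt_of_onePoint_twistedFlip_window_certificate_kkt (tp U μ h : ℝ) {r : ℚ} (q : ℕ)
    {Λ Λ' : Finset (Site 2)} (hΛ : Λ ⊆ Λ') (h8 : thicken Λ 1 ⊆ Λ')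
    (h0 : thicken ({0} : Finset (Site 2)) 1 ⊆ Λ') (hz : (0 : Site 2) ∈ Λ')
    (hP : pairRegion (insert (0 : Site 2) unitSteps) 0 ⊆ Λ')
    {S : Finset (DihedralGroup 4)} (h1 : (1 : DihedralGroup 4) ∈ S) (hmul : ∀ a ∈ S, ∀ b ∈ S, a * b ∈ S)
    {m : Type*} [Fintype m] [DecidableEq m] {Λm : Matrix m m ℂ} (hΛm : Λm.PosSemidef)
    (O : m → FermionOp Λ')
    {κ' : Type*} (s : Finset κ') (B : κ' → FermionOp Λ)
    {ι : Type*} (tt : Finset ι) (γ : ι → DihedralGroup 4) (hγS : ∀ l ∈ tt, γ l ∈ S) (wv : ι → Site 2)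
    (fl mt : ι → Fin 2) (hsh : ∀ l, d4ShiftSet (γ l) (wv l) Λ ⊆ Λ') (bb : ι → ℂ)
    (yw : ι → List (Orb (PolySite Λ) × Bool))
    {ρ : Type*} (uu : Finset ρ) (b : ρ → ℂ) (cw : ρ → List (Orb (PolySite Λ') × Bool))
    (hcw : ∀ j ∈ uu, ladderSpinCharge (cw j) ≠ 0)
    {δ : Type*} (ah : Finset δ) (dc : δ → ℝ) (V : δ → FermionOp Λ')
    {κ'' : Type*} (w : Finset κ'') (a : κ'' → ℂ) (word : κ'' → List (Orb (PolySite Λ') × Bool))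
    {β : Type*} [Fintype β] [DecidableEq β] {G : Matrix β β ℂ} (hG : G.PosSemidef)
    (Bk : β → FermionOp Λ) {c : ℝ}
    (hcert : -fermionEmbed (PolySite.incl hP) onePointPairWord - (c : ℂ) • (1 : FermionOp Λ') =
      gramForm Λm O +
        (∑ k ∈ s, (pairSourceWindowHamiltonianTT' dWaveFormFactor Λ' tp U μ h * fermionEmbed (PolySite.incl hΛ) (B k) -
            fermionEmbed (PolySite.incl hΛ) (B k) * pairSourceWindowHamiltonianTT' dWaveFormFactor Λ' tp U μ h) +
          ∑ l ∈ tt, bb l • (gaugePhase (twistFlipExp (γ l) (fl l) (mt l)) (yw l) •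
              fermionEmbed (PolySite.incl (hsh l))
                (fermionEmbed (PolySite.d4Emb (γ l) (wv l) Λ) (spinSwapIter (fl l).val (ladderWord (yw l)))) -
            fermionEmbed (PolySite.incl hΛ) (ladderWord (yw l))) +
          ∑ j ∈ uu, b j • ladderWord (cw j)) +
        (∑ m' ∈ ah, ((dc m' : ℝ) : ℂ) • ((V m')ᴴ - V m') + ∑ k ∈ w, a k • ladderWord (word k)) +
        kktForm (pairSourceWindowHamiltonianTT' dWaveFormFactor Λ' tp U μ h) G
          (fun b' => fermionEmbed (PolySite.incl hΛ) (Bk b')))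
    (hr : ((r : ℚ) : ℝ) ≤ c - ∑ k ∈ w, ‖a k‖) :
    ∃ L₀ : ℕ, PinFieldResponseCeilingAt tp U μ h q L₀ (-r / 2) := by
  obtain ⟨L₁, hL₁⟩ := exists_forall_le_injOn_proj (thicken Λ' 1)
  have hrow : SourcedCorrUpperRowGS tp U μ h q (max 3 L₁) (-r) (pairRegion (insert (0 : Site 2) unitSteps) 0)
      ({1} : Finset (DihedralGroup 4)) onePointPairWord := by
    intro L _ hInjP hL _
    have h3 : 3 ≤ L := le_trans (le_max_left _ _) hL
    have hInj : Set.InjOn (Torus.proj (d := 2) L) ↑(thicken Λ' 1) := hL₁ L (le_trans (le_max_right _ _) hL)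
    have hInj' : Set.InjOn (Torus.proj (d := 2) L) ↑Λ' := hInj.mono (by exact_mod_cast subset_thicken Λ' 1)
    refine SourcedTorusCorrUpperRowGS.onePoint_of_twistedFlip_bound_neg h1 hmul hP hInj' hInjP fun M ψ hψK hψ1 hgs => ?_
    exact hr.trans (re_orbitState_ge_of_twistedFlip_sourced_window_certificate_TT'_kkt tp U μ h h3 hΛ h8 h0 hz hP hInj
      hInj' h1 hmul hψK hψ1 hgs.2 _ hΛm O s B tt γ hγS wv fl mt hsh bb yw uu b cw hcw ah dc V w a word hG Bk hcert)
  exact ⟨max (max 3 L₁) 3, hrow.pinFieldResponseCeilingAt⟩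

end EndToEnd

/-! ## §4  Energy: twisted energy identities with a KKT block instantiate the energy FLOOR cell -/

section Energy

/-- **ENERGY window identity with twisted defects and a KKT block ⇒ the uniform energy FLOOR cell**
`∃ L₀, SourcedEnergyLowerRow tp U μ h q L₀ e` for `e ≤ c − Σₖ ‖aₖ‖` (every side progression `q`): the sourced
`e_lo(h)` row of the Hellmann–Feynman chords (`Observables/PinningFieldChords`) symmetrised over the full group
`(ℤ/L)² ⋊ D₄`. [cite: AraujoEtAl2023, §3.2 Prop. 11] [cite: Han2020Bootstrap, §3] -/
theorem SourcedEnergyLowerRow.of_twistedFlip_window_certificate_kkt (tp U μ h : ℝ) {e : ℚ} (q : ℕ)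
    {Λ Λ' : Finset (Site 2)} (hΛ : Λ ⊆ Λ') (h8 : thicken Λ 1 ⊆ Λ')
    (h0 : thicken ({0} : Finset (Site 2)) 1 ⊆ Λ') (hz : (0 : Site 2) ∈ Λ')
    (hP : pairRegion (insert (0 : Site 2) unitSteps) 0 ⊆ Λ')
    {m : Type*} [Fintype m] [DecidableEq m] {Λm : Matrix m m ℂ} (hΛm : Λm.PosSemidef)
    (O : m → FermionOp Λ')
    {κ : Type*} (s : Finset κ) (B : κ → FermionOp Λ)
    {ι : Type*} (tt : Finset ι) (γ : ι → DihedralGroup 4) (wv : ι → Site 2) (fl mt : ι → Fin 2)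
    (hsh : ∀ l, d4ShiftSet (γ l) (wv l) Λ ⊆ Λ') (bb : ι → ℂ) (yw : ι → List (Orb (PolySite Λ) × Bool))
    {χ : Type*} (u : Finset χ) (b : χ → ℂ) (cw : χ → List (Orb (PolySite Λ') × Bool))
    (hcw : ∀ j ∈ u, ladderSpinCharge (cw j) ≠ 0)
    {δ : Type*} (ah : Finset δ) (dc : δ → ℝ) (V : δ → FermionOp Λ')
    {κ'' : Type*} (w : Finset κ'') (a : κ'' → ℂ) (word : κ'' → List (Orb (PolySite Λ') × Bool))
    {β : Type*} [Fintype β] [DecidableEq β] {G : Matrix β β ℂ} (hG : G.PosSemidef)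
    (Bk : β → FermionOp Λ) {c : ℝ}
    (hcert : fermionEmbed (PolySite.incl h0) ((hubbardTTPrimeFermionInteraction 1 tp U).meanEnergyObs 1) -
          (μ : ℂ) • ∑ σ : Fin 2, nAt 0 hz σ -
          (h : ℂ) • (fermionEmbed (PolySite.incl hP) (localPairAt (insert (0 : Site 2) unitSteps) dWaveFormFactor 0) +
            (fermionEmbed (PolySite.incl hP) (localPairAt (insert (0 : Site 2) unitSteps) dWaveFormFactor 0))ᴴ) -
        (c : ℂ) • (1 : FermionOp Λ') =
      gramForm Λm O +
        (∑ k ∈ s, (pairSourceWindowHamiltonianTT' dWaveFormFactor Λ' tp U μ h * fermionEmbed (PolySite.incl hΛ) (B k) -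
            fermionEmbed (PolySite.incl hΛ) (B k) * pairSourceWindowHamiltonianTT' dWaveFormFactor Λ' tp U μ h) +
          ∑ l ∈ tt, bb l • (gaugePhase (twistFlipExp (γ l) (fl l) (mt l)) (yw l) •
              fermionEmbed (PolySite.incl (hsh l))
                (fermionEmbed (PolySite.d4Emb (γ l) (wv l) Λ) (spinSwapIter (fl l).val (ladderWord (yw l)))) -
            fermionEmbed (PolySite.incl hΛ) (ladderWord (yw l))) +
          ∑ j ∈ u, b j • ladderWord (cw j)) +
        (∑ m' ∈ ah, ((dc m' : ℝ) : ℂ) • ((V m')ᴴ - V m') + ∑ k ∈ w, a k • ladderWord (word k)) +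
        kktForm (pairSourceWindowHamiltonianTT' dWaveFormFactor Λ' tp U μ h) G
          (fun b' => fermionEmbed (PolySite.incl hΛ) (Bk b')))
    (he : ((e : ℚ) : ℝ) ≤ c - ∑ k ∈ w, ‖a k‖) :
    ∃ L₀ : ℕ, SourcedEnergyLowerRow tp U μ h q L₀ e := by
  obtain ⟨L₁, hL₁⟩ := exists_forall_le_injOn_proj (thicken Λ' 1)
  refine ⟨max 3 L₁, fun L _ hL _ => ?_⟩
  have h3 : 3 ≤ L := le_trans (le_max_left _ _) hL
  have hmain := dWaveSourceTorusTT'_groundEnergy_ge_of_twistedFlip_window_certificate_kkt tp U μ h h3 hΛ h8 h0 hz hP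
    (hL₁ L (le_trans (le_max_right _ _) hL)) hΛm O s B tt γ wv fl mt hsh bb yw u b cw hcw ah dc V w a word hG Bk hcert
  have hLsq : (0 : ℝ) ≤ (L : ℝ) ^ 2 := by positivity
  exact le_trans (mul_le_mul_of_nonneg_right he hLsq) hmain

end Energy

end Summit.Ventures.CertifiedManyBodySolver

end
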